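import Mathlib
import HarnessLib
import Summits.HubbardSuperconductivity.HubbardSuperconductivity.Theorems.KLProgrammeKLRegimeEngineWtLinesFlowDeep
import Summits.HubbardSuperconductivity.HubbardSuperconductivity.Theorems.KLProgrammePlainRowsUVCutBridge

/-!
# Route `KLProgramme` — ENGINE (stmt-HubbardSuperconductivity-20437 `KLRegimeEngineV17F2`), row (b): CURE (α) OF LOCATED #25 «(b)-PLAIN-UV-TAIL», LINK 1 —
# the (T3w)/`WtTupleLineAt`/`E4FlowAt`/`IsoFirstMomentsAt` suppliers RE-KEYED to the UV-CUT plain line (pen (R669): cure of record (α), build authorised)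
# (cell gate-hubbard-kl, seat hubbard-kl-k3c2-p2 g33)

Located #25: the PLAIN (`trivialMultiplier`) position-space quartic rows of row (b) are unsatisfiable as typed (the tree's `hubbardInteraction` conserves integer Matsubara
labels; plain currency of `V` = `(|U|/24)·Θ_M`, `Θ_M ∝ (ln M)²`, ✓ p765343).  Cure (α): state the plain rows for the LEG-RESCALED element
`𝒱_cut := map (mulLeft ĝ) 𝒱ₙ[Kₙ]`, `ĝ((k,σ),c) := C₁⁻¹(|ω_k|) = gnScaleCutoff 4 klE0 1 |ω_k|` (a smooth one-sector UV cutoff in the FREQUENCY only, ≡ 1 for `|ω| ≤ klE0`, ≡ 0 for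
`|ω| ≥ 4·klE0`; frame-independent), whose plain position kernel no longer contains the truncation tail.  The consumers lose nothing: every sector multiplier of the
programme (`klAnisoFamily … J = bgmMultiplier klE0 β e_K J`, radial factor `C_{−J}⁻¹(√(ω²+e_K²))` supported in `√(ω²+e²) < klE0·4^{−J} ≤ klE0`) ABSORBS the cut
(`klbv_klAnisoFamily_mul_uvCut`), so by the bridge `klbv_sectorisedKernel_map_mulLeft_of_absorb` (✓ p765436) the sectorised kernels of `𝒱_cut` ARE those of `𝒱`.
This file is the verbatim twin of `…EngineWtLinesFlowDeep` §2–§4 with the plain-line hypothesis on `𝒱_cut`: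
* `klbv_klAnisoFamily_mul_uvCut` — absorption; 
* `wtTupleLine_le_of_wplainLine_klEng_flow_deep_cut`, `wtTupleLineAt_of_wplainLine_klEng_flow_deep_cut` — (T3w) from the CUT plain line;
* **`e4FlowAt_of_wplainLine_flow_deep_cut`** — the `hE4` witness from the CUT plain-line family (the re-keyed `hplainE1` binder's consumer);
* **`isoFirstMomentsAt_of_wplainLine_klEng_flow_deep_cut`** — the `hexI` row from the same CUT line.
Next links (HANDOFF): `isoMomFlowAt_of_wplainLine_isoSingle_cut`, the (E4)-conjunct consumer of `hE₁`, and the row-(b) closer twin `A24a1G14.stub_engine_step_norms_of_E1data₃LBcut`.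
Everything is proved; no definitions; nothing asserts the cut plain line, row (b), any stub of 20437, K3 or superconductivity.
References: BGM 2006 §2.5 (2.48), §2.7 (2.70)–(2.71a), §2.8 (2.76)–(2.84) [cite: BenfattoGiulianiMastropietro2006].
-/

noncomputable section

namespace Summit.HubbardSuperconductivity.HubbardSuperconductivity.Theorems.EngineV8

set_option linter.dupNamespace false -- summit = problem name (single-conjunct summit), D-0017

open Classical
open Real Finset Literature.MathematicalPhysics.QuantumLattice Literature.Probability.LatticeModels GrassmannAlgebra
open Literature.Probability.LatticeModels.BattleFederbush
open Literature.MathematicalPhysics.QuantumLattice.FermiRG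
open Summit.HubbardSuperconductivity.HubbardSuperconductivity.Theorems.KLProgrammeLegKernels
open Summit.HubbardSuperconductivity.HubbardSuperconductivity.Theorems.KLRegimeSplit
open Summit.HubbardSuperconductivity.HubbardSuperconductivity.Theorems.TorusFourierL2
open Summit.HubbardSuperconductivity.HubbardSuperconductivity.Theorems.DispersionFlow

variable {L M : ℕ} [NeZero L] [NeZero M]

/-! ## §0 The UV cut is absorbed by every anisotropic sector family -/

omit [NeZero L] [NeZero M] in
/-- **Absorption**: `klAnisoFamily … J ω k · C₁⁻¹(|ω_k|) = klAnisoFamily … J ω k` — the BGM multiplier at scale `J ≥ 0` is supported where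
`√(ω_k² + e_K(k⃗)²) < klE0·4^{−J} ≤ klE0`, and there `C₁⁻¹(|ω_k|) = gnScaleCutoff 4 klE0 1 |ω_k| = 1`. -/
theorem klbv_klAnisoFamily_mul_uvCut (β μ : ℝ) (K : TrigPolyC4v) (J : ℕ) (ω : Fin (sectorCount J)) (k : FreqMomentum L M) :
    klAnisoFamily L M β μ K klE0 J ω k * ((gnScaleCutoff 4 klE0 1 |matsubaraFreq β M k.1| : ℝ) : ℂ) = klAnisoFamily L M β μ K klE0 J ω k := by
  refine klbv_absorb_of_eq_one_on_support (klAnisoFamily L M β μ K klE0 J) (fun k => ((gnScaleCutoff 4 klE0 1 |matsubaraFreq β M k.1| : ℝ) : ℂ)) ?_ ω k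
  intro ω k hne
  have he : (0 : ℝ) < klE0 := by norm_num [klE0]
  have h4 : (1 : ℝ) < 4 := by norm_num
  -- the radial cutoff factor is non-zero, hence `√(ω²+e²) < klE0·4^{-J}`
  have hrad : gnScaleCutoff 4 klE0 (-(J : ℤ)) (Real.sqrt (matsubaraFreq β M k.1 ^ 2 + nambuXiCT L μ K k.2 ^ 2)) ≠ 0 := by
    intro h0
    apply hne
    simp only [klAnisoFamily, bgmMultiplier, h0, zero_mul, Complex.ofReal_zero]
  have hlt : Real.sqrt (matsubaraFreq β M k.1 ^ 2 + nambuXiCT L μ K k.2 ^ 2) < klE0 * (4 : ℝ) ^ (-(J : ℤ)) := by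
    by_contra hge
    exact hrad (gnScaleCutoff_eq_zero h4 he (not_lt.mp hge))
  have hω : |matsubaraFreq β M k.1| ≤ Real.sqrt (matsubaraFreq β M k.1 ^ 2 + nambuXiCT L μ K k.2 ^ 2) := by
    rw [← Real.sqrt_sq_eq_abs]
    exact Real.sqrt_le_sqrt (by nlinarith [sq_nonneg (nambuXiCT L μ K k.2)])
  have hpow : (4 : ℝ) ^ (-(J : ℤ)) ≤ 1 := by
    rw [zpow_neg, zpow_natCast]
    exact inv_le_one_of_one_le₀ (one_le_pow₀ (by norm_num))
  have hle : |matsubaraFreq β M k.1| ≤ klE0 * (4 : ℝ) ^ ((1 : ℤ) - 1) := by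
    rw [sub_self, zpow_zero, mul_one]
    have := mul_le_mul_of_nonneg_left hpow he.le
    linarith
  rw [gnScaleCutoff_eq_one h4 he hle, Complex.ofReal_one]

/-! ## §1 (T3w) from the CUT plain line -/

/-- **THE E-b3 LEFT SIDE FROM THE WEIGHTED PLAIN FOUR-LEG LINE, OSC-FREE** (twin of `wtTupleLine_le_of_wplainLine_klEng_flow_all` on §1 at `(J, j) = (n, n)`):
`∃ CW > 0` such that, under the osc-free binders, for every `N₁ ≥ 0` bounding the `klScaleWt_n`-weighted plain four-leg pinned sums of `𝒱_n[K_n]` at leg `0` and every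
anisotropic 4-tuple `Ω`: the E-b3 left side is `≤ CW⁴·N₁`. [cite: BenfattoGiulianiMastropietro2006, §2.7 (2.70)-(2.71a), §2.8 (2.82)-(2.84)] -/
theorem wtTupleLine_le_of_wplainLine_klEng_flow_deep_cut :
    ∃ CW : ℝ, 0 < CW ∧
      ∀ (G : GeoConsts) (P : SplitConsts) (R : RenConsts) (Q : EngConsts) (cc : ℝ), R.WF2 → 0 < cc → cc ≤ klEngC₃6 P R →
      ∀ μ ∈ klWindowC, ∀ U : ℝ, 0 < U → U ≤ min (klEngU₀3 P R cc) (1 / (R.Gfr 3 + 1)) →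
      ∀ β : ℝ, klBetaMin ≤ β → β ≤ Real.exp (cc / U ^ 2) →
      ∀ (L M : ℕ) [NeZero L] [NeZero M], klEngL₃ β U ≤ L → klEngM₃ β U L ≤ M →
      ∀ n : ℕ, 1 ≤ n → n ≤ nScales β + 1 →
        HistP klPredsV17F2 L M G P Q R β U μ 0 n → FrameOK R U (nScales β) μ (klFlowFrameU L M β U μ n) →
        ∀ N₁ : ℝ, 0 ≤ N₁ →
          (∀ (τ' : Fin 4 → SectorLeg 1) (y : SpaceTimeIdx L M),
            imagTimeWeight β M ^ 3 * ∑ x' ∈ univ.filter (fun x' : Fin 4 → SpaceTimeIdx L M => x' 0 = y),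
              klScaleWt L M β n ((univ.image x').image (fun x : SpaceTimeIdx L M => (((((2 * (x.1 : ℕ) : ℕ)) : ZMod (2 * (2 * M)))), x.2))) *
                ‖sectorisedKernel L M β (trivialMultiplier L M)
                  (ExteriorAlgebra.map (LinearMap.mulLeft ℂ (fun K : HubbardFieldIdx L M => ((gnScaleCutoff 4 klE0 1 |matsubaraFreq β M K.1.1.1| : ℝ) : ℂ)))
                    (klEffectiveAction L M β U μ (klFlowFrameU L M β U μ n) klE0 n)) 4 τ' x'‖ ≤ N₁) →
          ∀ Ω : Fin 4 → SectorLeg (sectorCount n),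
            imagTimeWeight β M ^ 3 *
                ∑ x : Fin 3 → SpaceTimeIdx L M,
                  klScaleWt L M β n ((univ.image (fun j : Fin 4 => (Matrix.vecCons (0 : SpaceTimeIdx L M) x j, Ω j))).image
                      (latticeLegPos (2 * (2 * M)))) *
                    ‖klAnisoLegKernel L M β U μ (klFlowFrameU L M β U μ n) klE0 n 4 Ω (Matrix.vecCons (0 : SpaceTimeIdx L M) x)‖ ≤
              CW ^ 4 * N₁ := by
  obtain ⟨CT, hCT, hT⟩ := charSumWt_klAniso_single_flow_deep
  refine ⟨CT / 2, by positivity, ?_⟩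
  intro G P R Q cc hR2 hcc hcc6 μ hμ U hU hUle β hβmin hβc L M _ _ hL3 hM3 n hn1 hnN hhist hfr N₁ hN₁0 hplain Ω
  have hβ0 : 0 < β := KLRegimeSplit.pos_of_klBetaMin_le hβmin
  have hM0 : (0 : ℝ) < M := Nat.cast_pos.2 (Nat.pos_of_ne_zero (NeZero.ne M))
  have hL0 : (0 : ℝ) < L := Nat.cast_pos.2 (Nat.pos_of_ne_zero (NeZero.ne L))
  set K : TrigPolyC4v := klFlowFrameU L M β U μ n with hK
  set 𝒱 : HubbardGrassmann L M := klEffectiveAction L M β U μ K klE0 n with h𝒱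
  set 𝒱c : HubbardGrassmann L M := ExteriorAlgebra.map (LinearMap.mulLeft ℂ (fun K : HubbardFieldIdx L M =>
    ((gnScaleCutoff 4 klE0 1 |matsubaraFreq β M K.1.1.1| : ℝ) : ℂ))) 𝒱 with h𝒱c
  set gpos : SpaceTimeIdx L M → ZMod (2 * (2 * M)) × TorusSite 2 L :=
    fun x => (((((2 * (x.1 : ℕ) : ℕ)) : ZMod (2 * (2 * M)))), x.2) with hgpos
  have hT₁ := fun ω => hT G P R Q cc hR2 hcc hcc6 μ hμ U hU hUle β hβmin hβc L M hL3 hM3 n hn1 hnN hhist hfr n n hn1 le_rfl (Nat.le_succ n) le_rfl ω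
  have hc0 : 0 ≤ CT * M * (L : ℝ) ^ 2 / (β * (L : ℝ) ^ 2) := by positivity
  obtain ⟨hrowS, hcolS⟩ := transferSumsWt_klAniso_single_le hβ0 μ K n n hT₁
  have hwt : IsTreeWeight (klScaleWt L M β n) := isTreeWeight_klScaleWt L M hβ0.le n
  have hline := wprescribedSum_klAniso_le_of_plain_treeWt hwt gpos hβ0 μ K n 𝒱c hc0 hc0 hN₁0
    (fun ω'' σ' c x' => hcolS ω'' σ' c x') (fun ω'' σ' c x'' => hrowS ω'' σ' c x'') 3 Ω 0 hplain 0
  have hsum : ∑ x : Fin 3 → SpaceTimeIdx L M,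
      klScaleWt L M β n ((univ.image (fun j : Fin 4 => (Matrix.vecCons (0 : SpaceTimeIdx L M) x j, Ω j))).image (latticeLegPos (2 * (2 * M)))) *
        ‖klAnisoLegKernel L M β U μ K klE0 n 4 Ω (Matrix.vecCons (0 : SpaceTimeIdx L M) x)‖ =
      ∑ x'' ∈ univ.filter (fun x'' : Fin 4 → SpaceTimeIdx L M => x'' 0 = 0),
        klScaleWt L M β n ((univ.image x'').image gpos) * ‖sectorisedKernel L M β (klAnisoFamily L M β μ K klE0 n) 𝒱c 4 Ω x''‖ := by
    rw [sum_filter_apply_eq]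
    refine sum_congr rfl fun x _ => ?_
    rw [Fin.insertNth_zero', h𝒱c, klbv_sectorisedKernel_map_mulLeft_of_absorb β _ _ (klbv_klAnisoFamily_mul_uvCut β μ K n)]
    have hw : (univ.image (fun j : Fin 4 => (Matrix.vecCons (0 : SpaceTimeIdx L M) x j, Ω j))).image (latticeLegPos (2 * (2 * M))) =
        (univ.image (Fin.cons (0 : SpaceTimeIdx L M) x : Fin 4 → SpaceTimeIdx L M)).image gpos := by
      rw [image_latticeLegPos_eq_image_pos]
      rfl
    rw [hw]
    rfl
  rw [hsum]
  refine hline.trans (le_of_eq ?_)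
  have hq : CT * M * (L : ℝ) ^ 2 / (β * (L : ℝ) ^ 2) * imagTimeWeight β M = CT / 2 := by
    unfold imagTimeWeight
    field_simp
  calc (CT * M * (L : ℝ) ^ 2 / (β * (L : ℝ) ^ 2)) ^ 3 * (CT * M * (L : ℝ) ^ 2 / (β * (L : ℝ) ^ 2)) * imagTimeWeight β M ^ (3 + 1) * N₁
      = (CT * M * (L : ℝ) ^ 2 / (β * (L : ℝ) ^ 2) * imagTimeWeight β M) ^ 4 * N₁ := by ring
    _ = (CT / 2) ^ 4 * N₁ := by rw [hq]

/-- **`WtTupleLineAt` AT THE FLOW FRAME FROM THE WEIGHTED PLAIN LINE, OSC-FREE** (twin of `wtTupleLineAt_of_wplainLine_klEng_flow_all`): with `CW` of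
`wtTupleLine_le_of_wplainLine_klEng_flow_deep`, if the weighted plain pinned sums are `≤ N₁` and `CW⁴·N₁ ≤ klE0·(a·(P.Klam·|U|) + b·(P.Klam·U)²)`, then
`WtTupleLineAt L M a b P β U μ (klFlowFrameU L M β U μ n) n`. [cite: BenfattoGiulianiMastropietro2006, §2.8 (2.76)-(2.77)] -/
theorem wtTupleLineAt_of_wplainLine_klEng_flow_deep_cut :
    ∃ CW : ℝ, 0 < CW ∧
      ∀ (G : GeoConsts) (P : SplitConsts) (R : RenConsts) (Q : EngConsts) (cc : ℝ), R.WF2 → 0 < cc → cc ≤ klEngC₃6 P R →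
      ∀ μ ∈ klWindowC, ∀ U : ℝ, 0 < U → U ≤ min (klEngU₀3 P R cc) (1 / (R.Gfr 3 + 1)) →
      ∀ β : ℝ, klBetaMin ≤ β → β ≤ Real.exp (cc / U ^ 2) →
      ∀ (L M : ℕ) [NeZero L] [NeZero M], klEngL₃ β U ≤ L → klEngM₃ β U L ≤ M →
      ∀ n : ℕ, 1 ≤ n → n ≤ nScales β + 1 →
        HistP klPredsV17F2 L M G P Q R β U μ 0 n → FrameOK R U (nScales β) μ (klFlowFrameU L M β U μ n) →
        ∀ N₁ : ℝ, 0 ≤ N₁ →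
          (∀ (τ' : Fin 4 → SectorLeg 1) (y : SpaceTimeIdx L M),
            imagTimeWeight β M ^ 3 * ∑ x' ∈ univ.filter (fun x' : Fin 4 → SpaceTimeIdx L M => x' 0 = y),
              klScaleWt L M β n ((univ.image x').image (fun x : SpaceTimeIdx L M => (((((2 * (x.1 : ℕ) : ℕ)) : ZMod (2 * (2 * M)))), x.2))) *
                ‖sectorisedKernel L M β (trivialMultiplier L M)
                  (ExteriorAlgebra.map (LinearMap.mulLeft ℂ (fun K : HubbardFieldIdx L M => ((gnScaleCutoff 4 klE0 1 |matsubaraFreq β M K.1.1.1| : ℝ) : ℂ)))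
                    (klEffectiveAction L M β U μ (klFlowFrameU L M β U μ n) klE0 n)) 4 τ' x'‖ ≤ N₁) →
          ∀ a b : ℝ, CW ^ 4 * N₁ ≤ klE0 * (a * (P.Klam * |U|) + b * (P.Klam * U) ^ 2) →
            WtTupleLineAt L M a b P β U μ (klFlowFrameU L M β U μ n) n := by
  obtain ⟨CW, hCW, h⟩ := wtTupleLine_le_of_wplainLine_klEng_flow_deep_cut
  refine ⟨CW, hCW, ?_⟩
  intro G P R Q cc hR2 hcc hcc6 μ hμ U hU hUle β hβmin hβc L M _ _ hL3 hM3 n hn1 hnN hhist hfr N₁ hN₁0 hplain a b hab Ω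
  exact (h G P R Q cc hR2 hcc hcc6 μ hμ U hU hUle β hβmin hβc L M hL3 hM3 n hn1 hnN hhist hfr N₁ hN₁0 hplain Ω).trans hab

/-! ## §2 The `hE4` witness from the CUT plain-line family -/

/-- **THE (E4) FIRST-MOMENTS WITNESS OF ROW (b) FROM THE WEIGHTED PLAIN FOUR-LEG LINE — BY TYPE.**  If for an ABSOLUTE `a ≥ 0`, a table `bfun ≥ 0` and the
producer's own door `u₀ > 0`, the `klScaleWt_n`-weighted PLAIN four-leg pinned sums of `𝒱_n[K_n]` at leg `0` are `≤ klE0·(a·|U| + bfun·(P.Klam·U)²)` under EXACTLY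
the binders of `E4FlowAt` (well-formed `G P R Q`, `0 < cc ≤ klEngC₃6 P R`, `μ ∈ klWindowC`, `0 < U ≤ u₀ G P R Q cc`, the `β`-window, `klEngL₃/M₃`, `1 ≤ n ≤ n_β+1`,
`IsKLRegime`, `HistP … 0 n`, `FrameOK … (K_n)` — NO oscillation rows), then `∃ Eu, 0 ≤ Eu.1 ∧ (∀ G P R Q cc, 0 < Eu.2 G P R Q cc) ∧ E4FlowAt Eu.1 Eu.2` — the type
of `hE4` in `A24a1G14.stub_engine_step_norms_of_E1rows` (p727075): `e4FlowAt_of_wtTupleLine` ∘ `wtTupleLineAt_of_wplainLine_klEng_flow_deep`, threshold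
`u₀ ⊓ klEngU₀3 ⊓ 1/(|Gfr₃|+1) ⊓ E/(2(|CW⁴·bfun|·Klam + 1))`, `E = 2·max (CW⁴·a) 1`; the Klam-free leading term serves by `1 ≤ P.Klam`.
[cite: BenfattoGiulianiMastropietro2006, §2.7 (2.70)-(2.71a), §2.8 (2.76)-(2.77), §3 (3.2)-(3.8)] -/
theorem e4FlowAt_of_wplainLine_flow_deep_cut {a : ℝ} (ha : 0 ≤ a) {bfun u₀ : GeoConsts → SplitConsts → RenConsts → EngConsts → ℝ → ℝ}
    (hb : ∀ G P R Q cc, 0 ≤ bfun G P R Q cc) (hu₀ : ∀ G P R Q cc, 0 < u₀ G P R Q cc)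
    (hplain : ∀ (G : GeoConsts), G.WF → ∀ (P : SplitConsts) (R : RenConsts) (Q : EngConsts) (cc : ℝ), P.WF → R.WF2 → Q.WF → 0 < cc →
      cc ≤ klEngC₃6 P R → ∀ μ ∈ klWindowC, ∀ U : ℝ, 0 < U → U ≤ u₀ G P R Q cc →
      ∀ β : ℝ, klBetaMin ≤ β → β ≤ Real.exp (cc / U ^ 2) →
      ∀ (L M : ℕ) [NeZero L] [NeZero M], klEngL₃ β U ≤ L → klEngM₃ β U L ≤ M →
      ∀ n : ℕ, 1 ≤ n → n ≤ nScales β + 1 → IsKLRegime U cc (-(n : ℤ)) →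
        HistP klPredsV17F2 L M G P Q R β U μ 0 n → FrameOK R U (nScales β) μ (klFlowFrameU L M β U μ n) →
        ∀ (τ' : Fin 4 → SectorLeg 1) (y : SpaceTimeIdx L M),
          imagTimeWeight β M ^ 3 * ∑ x' ∈ univ.filter (fun x' : Fin 4 → SpaceTimeIdx L M => x' 0 = y),
            klScaleWt L M β n ((univ.image x').image (fun x : SpaceTimeIdx L M => (((((2 * (x.1 : ℕ) : ℕ)) : ZMod (2 * (2 * M)))), x.2))) *
              ‖sectorisedKernel L M β (trivialMultiplier L M)
                (ExteriorAlgebra.map (LinearMap.mulLeft ℂ (fun K : HubbardFieldIdx L M => ((gnScaleCutoff 4 klE0 1 |matsubaraFreq β M K.1.1.1| : ℝ) : ℂ)))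
                    (klEffectiveAction L M β U μ (klFlowFrameU L M β U μ n) klE0 n)) 4 τ' x'‖ ≤
          klE0 * (a * |U| + bfun G P R Q cc * (P.Klam * U) ^ 2)) :
    ∃ Eu : ℝ × (GeoConsts → SplitConsts → RenConsts → EngConsts → ℝ → ℝ),
      0 ≤ Eu.1 ∧ (∀ G P R Q cc, 0 < Eu.2 G P R Q cc) ∧ E4FlowAt Eu.1 Eu.2 := by
  obtain ⟨CW, hCW, hT⟩ := wtTupleLineAt_of_wplainLine_klEng_flow_deep_cut
  have he : (0 : ℝ) < klE0 := by norm_num [klE0]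
  set u₁ : GeoConsts → SplitConsts → RenConsts → EngConsts → ℝ → ℝ :=
    fun G P R Q cc => min (u₀ G P R Q cc) (min (klEngU₀3 P R cc) (1 / (|R.Gfr 3| + 1))) with hu₁
  have hu₁pos : ∀ G P R Q cc, 0 < u₁ G P R Q cc := fun G P R Q cc =>
    lt_min (hu₀ G P R Q cc) (lt_min (klEngU₀3_pos P R cc) (by positivity))
  have hline : ∀ (G : GeoConsts), G.WF → ∀ (P : SplitConsts) (R : RenConsts) (Q : EngConsts) (cc : ℝ), P.WF → R.WF2 → Q.WF → 0 < cc →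
      cc ≤ klEngC₃6 P R → ∀ μ ∈ klWindowC, ∀ U : ℝ, 0 < U → U ≤ u₁ G P R Q cc →
      ∀ β : ℝ, klBetaMin ≤ β → β ≤ Real.exp (cc / U ^ 2) →
      ∀ (L M : ℕ) [NeZero L] [NeZero M], klEngL₃ β U ≤ L → klEngM₃ β U L ≤ M →
      ∀ n : ℕ, 1 ≤ n → n ≤ nScales β + 1 → IsKLRegime U cc (-(n : ℤ)) →
        HistP klPredsV17F2 L M G P Q R β U μ 0 n → FrameOK R U (nScales β) μ (klFlowFrameU L M β U μ n) →
          WtTupleLineAt L M (CW ^ 4 * a) (CW ^ 4 * bfun G P R Q cc) P β U μ (klFlowFrameU L M β U μ n) n := by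
    intro G hG P R Q cc hP hR hQ hcc hcc6 μ hμ U hU hUu β hβ hβc L M _ _ hL hM n hn1 hn hreg hhist hfr
    have hU0 : U ≤ u₀ G P R Q cc := hUu.trans (min_le_left _ _)
    have h3 : 0 ≤ R.Gfr 3 := gfr_nonneg_of_wf2 hR 3
    have hUle : U ≤ min (klEngU₀3 P R cc) (1 / (R.Gfr 3 + 1)) := by
      have h := hUu.trans (min_le_right _ _)
      rwa [abs_of_nonneg h3] at h
    have hK : 1 ≤ P.Klam := hP.1
    have hN₁0 : 0 ≤ klE0 * (a * |U| + bfun G P R Q cc * (P.Klam * U) ^ 2) := by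
      have := hb G P R Q cc
      positivity
    refine hT G P R Q cc hR hcc hcc6 μ hμ U hU hUle β hβ hβc L M hL hM n hn1 hn hhist hfr _ hN₁0
      (hplain G hG P R Q cc hP hR hQ hcc hcc6 μ hμ U hU hU0 β hβ hβc L M hL hM n hn1 hn hreg hhist hfr) _ _ ?_
    -- `CW⁴·klE0·(a|U| + b(Klam U)²) ≤ klE0·(CW⁴a·(Klam|U|) + CW⁴b·(Klam U)²)` since `|U| ≤ Klam·|U|` (`1 ≤ Klam`)
    have h1 : a * |U| ≤ a * (P.Klam * |U|) := mul_le_mul_of_nonneg_left (le_mul_of_one_le_left (abs_nonneg U) hK) ha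
    have h2 : 0 ≤ klE0 * CW ^ 4 := mul_nonneg he.le (pow_nonneg hCW.le 4)
    nlinarith [mul_le_mul_of_nonneg_left h1 h2]
  exact ⟨(2 * max (CW ^ 4 * a) 1, fun G P R Q cc => min (u₁ G P R Q cc) ((2 * max (CW ^ 4 * a) 1) / (2 * (|CW ^ 4 * bfun G P R Q cc| * |P.Klam| + 1)))),
    by positivity, fun G P R Q cc => e4Threshold_pos (hu₁pos G P R Q cc) (by positivity), e4FlowAt_of_wtTupleLine hline⟩

/-! ## §3 The `hexI` row from the CUT plain line -/

/-- **`IsoFirstMomentsAt` FROM THE WEIGHTED PLAIN FOUR-LEG LINE, OSC-FREE** (`2 ≤ n`; thin index `n − 1`): `∃ CW > 0` such that, under the osc-free binders of §1,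
for every `N₁ ≥ 0` bounding the `klScaleWt_n`-weighted plain four-leg pinned sums of `𝒱_n[K_n]` at leg `0`, every `T m ≥ 0` bounding the weighted iso(m) × thin(n−1)
character sums at rate `Λ_m` (`n ≤ m ≤ n_β`) and every `cM, cM′` with `(3·T m/(βL²))⁴·27⁴·ε⁴·(CW⁴·N₁) ≤ cM·|U| + cM′·(P.Klam·U)²`: `IsoFirstMomentsAt L M cM cM′ P β U μ n`
(`isoFirstMomentsAt_of_wtAnisoLines_rate` fed by §1 at `(J, j) = (n−1, n)`). [cite: BenfattoGiulianiMastropietro2006, §2.7 (2.70)-(2.71a), §2.8 (2.76)-(2.84), §3 (3.5)-(3.6)] -/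
theorem isoFirstMomentsAt_of_wplainLine_klEng_flow_deep_cut :
    ∃ CW : ℝ, 0 < CW ∧
      ∀ (G : GeoConsts) (P : SplitConsts) (R : RenConsts) (Q : EngConsts) (cc : ℝ), R.WF2 → 0 < cc → cc ≤ klEngC₃6 P R →
      ∀ μ ∈ klWindowC, ∀ U : ℝ, 0 < U → U ≤ min (klEngU₀3 P R cc) (1 / (R.Gfr 3 + 1)) →
      ∀ β : ℝ, klBetaMin ≤ β → β ≤ Real.exp (cc / U ^ 2) →
      ∀ (L M : ℕ) [NeZero L] [NeZero M], klEngL₃ β U ≤ L → klEngM₃ β U L ≤ M →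
      ∀ n : ℕ, 2 ≤ n → n ≤ nScales β + 1 →
        HistP klPredsV17F2 L M G P Q R β U μ 0 n → FrameOK R U (nScales β) μ (klFlowFrameU L M β U μ n) →
        ∀ N₁ : ℝ, 0 ≤ N₁ →
          (∀ (τ' : Fin 4 → SectorLeg 1) (y : SpaceTimeIdx L M),
            imagTimeWeight β M ^ 3 * ∑ x' ∈ univ.filter (fun x' : Fin 4 → SpaceTimeIdx L M => x' 0 = y),
              klScaleWt L M β n ((univ.image x').image (fun x : SpaceTimeIdx L M => (((((2 * (x.1 : ℕ) : ℕ)) : ZMod (2 * (2 * M)))), x.2))) *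
                ‖sectorisedKernel L M β (trivialMultiplier L M)
                  (ExteriorAlgebra.map (LinearMap.mulLeft ℂ (fun K : HubbardFieldIdx L M => ((gnScaleCutoff 4 klE0 1 |matsubaraFreq β M K.1.1.1| : ℝ) : ℂ)))
                    (klEffectiveAction L M β U μ (klFlowFrameU L M β U μ n) klE0 n)) 4 τ' x'‖ ≤ N₁) →
          ∀ T : ℕ → ℝ, (∀ m, 0 ≤ T m) →
          (∀ m, n ≤ m → m ≤ nScales β → ∀ (σ : Fin (sectorCount (2 * m))) (a' : Fin (sectorCount (n - 1))),
            ∑ z : TorusSite 1 (2 * M) × TorusSite 2 L,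
              (1 + klScale klE0 m * β / (2 * M) * |(((z.1 0).valMinAbs : ℤ) : ℝ)| + klScale klE0 m * |(((z.2 0).valMinAbs : ℤ) : ℝ)| +
                  klScale klE0 m * |(((z.2 1).valMinAbs : ℤ) : ℝ)|) *
              ‖∑ q : TorusSite 1 (2 * M) × TorusSite 2 L, (torusChar q.1 z.1 * torusChar q.2 z.2) •
                (klIsoFamily L M β μ (klFlowFrameU L M β U μ n) klE0 m σ (⟨(q.1 0).val, ZMod.val_lt (q.1 0)⟩, q.2) *
                  klAnisoFamily L M β μ (klFlowFrameU L M β U μ n) klE0 (n - 1) a' (⟨(q.1 0).val, ZMod.val_lt (q.1 0)⟩, q.2))‖ ≤ T m) →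
          ∀ cM cM' : ℝ,
          (∀ m, n ≤ m → m ≤ nScales β →
            (3 * T m / (β * (L : ℝ) ^ 2)) ^ 3 * (3 * T m / (β * (L : ℝ) ^ 2)) * 27 ^ 4 * imagTimeWeight β M ^ 3 *
              (imagTimeWeight β M * (CW ^ 4 * N₁)) ≤ cM * |U| + cM' * (P.Klam * U) ^ 2) →
            IsoFirstMomentsAt L M cM cM' P β U μ n := by
  obtain ⟨CT, hCT, hT⟩ := charSumWt_klAniso_single_flow_deep
  refine ⟨CT / 2, by positivity, ?_⟩
  intro G P R Q cc hR2 hcc hcc6 μ hμ U hU hUle β hβmin hβc L M _ _ hL3 hM3 n hn2 hnN hhist hfr N₁ hN₁0 hplain Tm hTm0 hiso cM cM' hfit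
  have hn1 : 1 ≤ n := le_trans (by norm_num) hn2
  have hβ0 : 0 < β := KLRegimeSplit.pos_of_klBetaMin_le hβmin
  have hM0 : (0 : ℝ) < M := Nat.cast_pos.2 (Nat.pos_of_ne_zero (NeZero.ne M))
  have hL0 : (0 : ℝ) < L := Nat.cast_pos.2 (Nat.pos_of_ne_zero (NeZero.ne L))
  set K : TrigPolyC4v := klFlowFrameU L M β U μ n with hK
  set 𝒱 : HubbardGrassmann L M := klEffectiveAction L M β U μ K klE0 n with h𝒱
  set 𝒱c : HubbardGrassmann L M := ExteriorAlgebra.map (LinearMap.mulLeft ℂ (fun K : HubbardFieldIdx L M =>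
    ((gnScaleCutoff 4 klE0 1 |matsubaraFreq β M K.1.1.1| : ℝ) : ℂ))) 𝒱 with h𝒱c
  set gpos : SpaceTimeIdx L M → ZMod (2 * (2 * M)) × TorusSite 2 L :=
    fun x => (((((2 * (x.1 : ℕ) : ℕ)) : ZMod (2 * (2 * M)))), x.2) with hgpos
  -- the osc-free weighted single character sums of the THIN family of index `n − 1`, rate `n`, at the flow frame
  have hT₁ := fun ω => hT G P R Q cc hR2 hcc hcc6 μ hμ U hU hUle β hβmin hβc L M hL3 hM3 n hn1 hnN hhist hfr (n - 1) n
    (by omega) (Nat.sub_le n 1) (by omega) le_rfl ω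
  have hc0 : 0 ≤ CT * M * (L : ℝ) ^ 2 / (β * (L : ℝ) ^ 2) := by positivity
  obtain ⟨hrowS, hcolS⟩ := transferSumsWt_klAniso_single_le hβ0 μ K (n - 1) n hT₁
  have hwt : IsTreeWeight (klScaleWt L M β n) := isTreeWeight_klScaleWt L M hβ0.le n
  have hq : CT * M * (L : ℝ) ^ 2 / (β * (L : ℝ) ^ 2) * imagTimeWeight β M = CT / 2 := by
    unfold imagTimeWeight
    field_simp
  have hBF : ∀ (σ' : Fin 4 → SectorLeg (sectorCount (n - 1))) (y : SpaceTimeIdx L M),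
      imagTimeWeight β M ^ 3 * ∑ x' ∈ univ.filter (fun x' : Fin 4 → SpaceTimeIdx L M => x' 0 = y),
        klScaleWt L M β n ((univ.image x').image gpos) * ‖klAnisoKernelAt L M β U μ K n (n - 1) σ' x'‖ ≤ (CT / 2) ^ 4 * N₁ := by
    intro σ' y
    have hline := wprescribedSum_klAniso_le_of_plain_treeWt hwt gpos hβ0 μ K (n - 1) 𝒱c hc0 hc0 hN₁0
      (fun ω'' s c x' => hcolS ω'' s c x') (fun ω'' s c x'' => hrowS ω'' s c x'') 3 σ' 0 hplain y
    have hid : ∀ x' : Fin 4 → SpaceTimeIdx L M, klAnisoKernelAt L M β U μ K n (n - 1) σ' x' =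
        sectorisedKernel L M β (klAnisoFamily L M β μ K klE0 (n - 1)) 𝒱c 4 σ' x' := fun x' => by
      rw [h𝒱c, klbv_sectorisedKernel_map_mulLeft_of_absorb β _ _ (klbv_klAnisoFamily_mul_uvCut β μ K (n - 1))]; rfl
    simp_rw [hid]
    refine hline.trans (le_of_eq ?_)
    calc (CT * M * (L : ℝ) ^ 2 / (β * (L : ℝ) ^ 2)) ^ 3 * (CT * M * (L : ℝ) ^ 2 / (β * (L : ℝ) ^ 2)) * imagTimeWeight β M ^ (3 + 1) * N₁
        = (CT * M * (L : ℝ) ^ 2 / (β * (L : ℝ) ^ 2) * imagTimeWeight β M) ^ 4 * N₁ := by ring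
      _ = (CT / 2) ^ 4 * N₁ := by rw [hq]
  exact isoFirstMomentsAt_of_wtAnisoLines_rate hβ0 U μ P n (n₂ := n - 1) (by omega) hTm0 (by positivity) hiso hBF hfit

end Summit.HubbardSuperconductivity.HubbardSuperconductivity.Theorems.EngineV8

end
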